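import Summits.BirchSwinnertonDyer.BirchSwinnertonDyer.Theorems.EisensteinPrimesBSDpOnCellCRetractionSpecializationCyclic
import Literature.NumberTheory.EllipticCurves.IwasawaAlgebraSemilinearCharIdealProofs
import HarnessLib

/-!
# Specialisation of characteristic ideals along a retraction `φ : B → A` with kernel `(π)`:
# the Herbrand formula and its one-sided form (proofs)

Helper file for crux 4 `BSDpOnCellC` (stmt-BirchSwinnertonDyer-19034, line «telescope» v4, registered stub
`stub_herbrandTranslate`; width seat `bsd-line-x2-p2`, `--supports`). Sequel of
`…EisensteinPrimesBSDpOnCellCRetractionSpecializationCyclic.lean`; GENERALISES the tree's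
`Theorems/SignedBaseChangeAnticyclotomicEisensteinDivisibilitySpecializationHerbrand.lean`
(`PowerSeriesSpecialization.lengthAt_quotSMulTop_eq_add` / `charIdeal_quotSMulTop_eq_mul`, the case `B = A⟦X⟧`,
`π = X`, `φ = constantCoeff`) to an `A`-algebra `B` with a ring retraction `φ : B →+* A` whose kernel is `(π)`.
PROVED here, for Noetherian domains `A`, `B` with `B` factorial (and `A` factorial for the global forms):

* `lengthAt_quotSMulTop_eq_add_of_retraction` — **local Herbrand formula** (`π ≠ 0`): for a finitely generated
  `B`-module `N` killed by some `s` with `φ s ≠ 0` and any compatible `A`-structure, at every height-one prime `𝔮` of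
  `A`: `ℓ_𝔮(N/πN) = ℓ_𝔮(N[π]) + ℓ_𝔮(A/φ(char_B N))`. Dévissage over a prime filtration of `N` (Mathlib
  `IsNoetherianRing.induction_on_isQuotientEquivQuotientPrime`; the motive quantifies over the compatible
  `A`-structures): additivity by the snake (`LocalLength.lengthAt_smul_snake`, already generic in the tree) and by
  `lengthAt_quotient_map_charIdeal_eq_add_of_retraction`, cyclic modules by `lengthAt_cyclic_of_retraction`;
* `charIdeal_quotSMulTop_eq_mul_of_retraction` — **global Herbrand formula** (`π ≠ 0`)
  `char_A(N/πN) = char_A(N[π]) · φ(char_B N)` as ideals of `A`;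
* `charIdeal_quotSMulTop_eq_map_of_retraction` — the case `N[π] = 0`: `char_A(N/πN) = φ(char_B N)`;
* `charIdeal_quotSMulTop_le_map_of_retraction` — the **one-sided form** `char_A(N/πN) ≤ φ(char_B N)` for EVERY `π`
  (for `π ≠ 0` drop the factor `char_A(N[π])`; for `π = 0` the retraction `φ` is a ring isomorphism, `N/0N = N`, and
  the tree's semilinear transport `Module.charIdeal_eq_map_of_semilinearEquiv` gives equality) — this is the text of the
  registered stub `stub_herbrandTranslate` with universe-polymorphic binders; the stub itself (binders in `Type`) is
  landed in `…EisensteinPrimesBSDpOnCellCStubHerbrandTranslate.lean`.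

The OPPOSITE containment `φ(char_B N) ≤ char_A(N/πN)` is false in general (pseudo-null `B`-modules such as `B/(p, π)`
contribute `(p)` to the fibre and `(1)` to `φ(char_B)`), which is why the crux's witness states member control
one-sidedly. Theorems only, [folklore] commutative algebra; nothing about elliptic curves is asserted; no summit
statement or crux is proved here; BSD is proved for no curve.

## References

* N. Bourbaki, *Algèbre commutative*, Ch. VII §4.4–4.5 (Prop. 10). [BourbakiAC5to7]
* D. Delbourgo, *Elliptic Curves and Big Galois Representations*, LMS LNS 356 (2008), Ch. X Lemma 10.5 (the torsion
  case of the leading-term formula is the two-sided Herbrand identity). [Delbourgo2008]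
* T. Ochiai, Compos. Math. 142 (2006), Lemma 7.2. [Ochiai2006]
* C. Skinner, E. Urban, Invent. Math. 195 (2014), §3.1.6, Cor. 3.2.9. [SkinnerUrban2014]
-/

noncomputable section

open Function
open scoped Pointwise

-- D-0017: single-problem summit, the namespace repeats the problem name by design.
set_option linter.dupNamespace false
set_option autoImplicit false

namespace Summit.BirchSwinnertonDyer.BirchSwinnertonDyer.Theorems.RetractionSpecialization

open Literature.NumberTheory.EllipticCurves Literature.NumberTheory.EllipticCurves.Module
open Summit.BirchSwinnertonDyer.BirchSwinnertonDyer.Theorems.SignedBaseChangeAcDivSpecialization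
open Summit.BirchSwinnertonDyer.BirchSwinnertonDyer.Theorems.SignedBaseChangeAcDivSpecialization.LocalLength

universe u w v

variable {A : Type u} {B : Type w} [CommRing A] [CommRing B] [Algebra A B] {π : B} {φ : B →+* A}

/-! ### Dévissage: the local Herbrand formula -/

section Devissage

variable [IsDomain A] [IsNoetherianRing A] [IsDomain B] [IsNoetherianRing B] [UniqueFactorizationMonoid B]

/-- **Local Herbrand formula along a retraction.** Let `B` be a factorial Noetherian domain, an `A`-algebra over the
Noetherian domain `A` with a ring retraction `φ : B → A` whose kernel is `(π)`, `π ≠ 0`, and `N` a finitely generated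
`B`-module killed by some `s` with `φ s ≠ 0` (equivalently: `N` is torsion and `N_{(π)} = 0`), with any compatible
`A`-structure. Then for every height-one prime `𝔮` of `A`, `ℓ_𝔮(N/πN) = ℓ_𝔮(N[π]) + ℓ_𝔮(A/φ(char_B N))`, where
`φ(char_B N)` is the image of the (principal) characteristic ideal. Proof by dévissage over a prime filtration of `N`
(Mathlib `IsNoetherianRing.induction_on_isQuotientEquivQuotientPrime`): the Herbrand-type quantity
`ℓ_𝔮(·/π·) − ℓ_𝔮(·[π])` is additive by the snake lemma (`lengthAt_smul_snake`), so is `ℓ_𝔮(A/φ(char ·))`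
(`lengthAt_quotient_map_charIdeal_eq_add_of_retraction`), and the cyclic modules are `lengthAt_cyclic_of_retraction`
(Bourbaki AC VII §4.5). [folklore] -/
theorem lengthAt_quotSMulTop_eq_add_of_retraction (hφ : ∀ a : A, φ (algebraMap A B a) = a) (hφπ : φ π = 0)
    (hker : ∀ b : B, φ b = 0 → π ∣ b) (hπ0 : π ≠ 0)
    (N : Type v) [AddCommGroup N] [Module B N] (hfin : Module.Finite B N) :
    ∀ [Module A N] [IsScalarTower A B N],
      (∃ s : B, φ s ≠ 0 ∧ ∀ m : N, s • m = 0) →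
      ∀ 𝔮 : PrimeSpectrum A, 𝔮.asIdeal.height = 1 →
        lengthAt A (QuotSMulTop π N) 𝔮 =
          lengthAt A (Submodule.torsionBy B N π) 𝔮 +
            lengthAt A (A ⧸ (charIdeal B N).map φ) 𝔮 := by
  refine IsNoetherianRing.induction_on_isQuotientEquivQuotientPrime (A := B) hfin
    (motive := fun N _ _ _ => ∀ [Module A N] [IsScalarTower A B N],
      (∃ s : B, φ s ≠ 0 ∧ ∀ m : N, s • m = 0) →
      ∀ 𝔮 : PrimeSpectrum A, 𝔮.asIdeal.height = 1 →
        lengthAt A (QuotSMulTop π N) 𝔮 =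
          lengthAt A (Submodule.torsionBy B N π) 𝔮 +
            lengthAt A (A ⧸ (charIdeal B N).map φ) 𝔮) ?_ ?_ ?_
  · -- the zero module
    intro N _ _ _ _ _ _ _ 𝔮 _
    haveI : Subsingleton (QuotSMulTop π N) := (Submodule.mkQ_surjective _).subsingleton
    rw [lengthAt_eq_zero_of_subsingleton, lengthAt_eq_zero_of_subsingleton,
      charIdeal_eq_one_of_subsingleton, Ideal.one_eq_top, Ideal.map_top,
      PowerSeriesSpecialization.lengthAt_quotient_top, zero_add]
  · -- cyclic modules `N ≃ B/𝔭`
    intro N _ _ _ 𝔭 e _ _ hs 𝔮 h𝔮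
    obtain ⟨s, hs0, hs⟩ := hs
    have hsmem : s ∈ 𝔭.asIdeal := by
      have h1 : s • (Ideal.Quotient.mk 𝔭.asIdeal 1) = 0 := by
        have := congrArg e (hs (e.symm (Ideal.Quotient.mk 𝔭.asIdeal 1)))
        rwa [LinearEquiv.map_smul, LinearEquiv.apply_symm_apply, map_zero] at this
      change Ideal.Quotient.mk 𝔭.asIdeal (s * 1) = 0 at h1
      rwa [mul_one, Ideal.Quotient.eq_zero_iff_mem] at h1
    have h0 : 𝔭.asIdeal ≠ ⊥ := fun h => hs0 (by
      rw [h, Ideal.mem_bot] at hsmem; rw [hsmem, map_zero])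
    have hX : 𝔭.asIdeal ≠ Ideal.span {π} := fun h =>
      hs0 ((mem_span_iff_map_eq_zero hφπ hker).mp (h ▸ hsmem))
    have h1 : lengthAt A (QuotSMulTop π N) 𝔮 = lengthAt A (QuotSMulTop π (B ⧸ 𝔭.asIdeal)) 𝔮 :=
      lengthAt_eq_of_linearEquiv ((QuotSMulTop.congr π e).restrictScalars A) 𝔮
    have h2a : lengthAt A (Submodule.torsionBy B N π) 𝔮 ≤
        lengthAt A (Submodule.torsionBy B (B ⧸ 𝔭.asIdeal) π) 𝔮 :=
      LocalLength.lengthAt_le_of_injective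
        ((e.toLinearMap.restrict (Literature.RingTheory.Length.mapsTo_torsionBy π
          e.toLinearMap)).restrictScalars A)
        (Literature.RingTheory.Length.restrict_torsionBy_injective π e.toLinearMap e.injective) 𝔮
    have h2b : lengthAt A (Submodule.torsionBy B (B ⧸ 𝔭.asIdeal) π) 𝔮 ≤
        lengthAt A (Submodule.torsionBy B N π) 𝔮 :=
      LocalLength.lengthAt_le_of_injective
        ((e.symm.toLinearMap.restrict (Literature.RingTheory.Length.mapsTo_torsionBy π
          e.symm.toLinearMap)).restrictScalars A)
        (Literature.RingTheory.Length.restrict_torsionBy_injective π e.symm.toLinearMap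
          e.symm.injective) 𝔮
    have h2 := le_antisymm h2a h2b
    rw [h1, h2, LocalLength.charIdeal_eq_of_linearEquiv e]
    exact lengthAt_cyclic_of_retraction hφ hφπ hker hπ0 𝔭 h0 hX 𝔮 h𝔮
  · -- short exact sequences
    intro N₁ _ _ _ N₂ _ _ _ N₃ _ _ _ f g hf hg hfg ih₁ ih₃ _ _ hs 𝔮 h𝔮
    obtain ⟨s, hs0, hs⟩ := hs
    -- the `A`-structures on `N₁`, `N₃` by restriction along `A → B`
    letI : Module A N₁ := Module.compHom N₁ (algebraMap A B)
    haveI : IsScalarTower A B N₁ := IsScalarTower.of_algebraMap_smul fun _ _ => rfl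
    letI : Module A N₃ := Module.compHom N₃ (algebraMap A B)
    haveI : IsScalarTower A B N₃ := IsScalarTower.of_algebraMap_smul fun _ _ => rfl
    have hs₁ : ∀ m : N₁, s • m = 0 := fun m => hf (by rw [map_smul, hs, map_zero])
    have hs₃ : ∀ m : N₃, s • m = 0 := fun m => by
      obtain ⟨n, rfl⟩ := hg m; rw [← map_smul, hs, map_zero]
    have e₁ := ih₁ ⟨s, hs0, hs₁⟩ 𝔮 h𝔮
    have e₃ := ih₃ ⟨s, hs0, hs₃⟩ 𝔮 h𝔮
    have hsnake := lengthAt_smul_snake (A := A) π f g hf hg hfg 𝔮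
    have hr := lengthAt_quotient_map_charIdeal_eq_add_of_retraction (A := A) hφπ hker hπ0 f g hf hg
      hfg hs0 hs 𝔮
    -- finiteness of the four outer lengths
    haveI : IsNoetherian B N₂ := isNoetherian_of_isNoetherianRing_of_finite _ _
    haveI : Module.Finite A (QuotSMulTop π N₁) := moduleFinite_quotSMulTop_of_retraction hφ hker
    haveI : Module.Finite A (QuotSMulTop π N₃) := moduleFinite_quotSMulTop_of_retraction hφ hker
    haveI : Module.Finite A (Submodule.torsionBy B N₁ π) := moduleFinite_torsionBy_of_retraction hφ hker
    haveI : Module.Finite A (Submodule.torsionBy B N₃ π) := moduleFinite_torsionBy_of_retraction hφ hker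
    have hq1 : 𝔮.asIdeal.height ≤ 1 := le_of_eq h𝔮
    have fK₁ := lengthAt_ne_top_of_isTorsionBy hs0 (isTorsionBy_map_of_retraction' hφ hker hs₁).2 𝔮 hq1
    have fK₃ := lengthAt_ne_top_of_isTorsionBy hs0 (isTorsionBy_map_of_retraction' hφ hker hs₃).2 𝔮 hq1
    have fC₁ := lengthAt_ne_top_of_isTorsionBy hs0 (isTorsionBy_map_of_retraction' hφ hker hs₁).1 𝔮 hq1
    have fC₃ := lengthAt_ne_top_of_isTorsionBy hs0 (isTorsionBy_map_of_retraction' hφ hker hs₃).1 𝔮 hq1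
    -- bookkeeping in `ℕ∞`
    generalize lengthAt A (QuotSMulTop π N₁) 𝔮 = c₁ at *
    generalize lengthAt A (QuotSMulTop π N₂) 𝔮 = c₂ at *
    generalize lengthAt A (QuotSMulTop π N₃) 𝔮 = c₃ at *
    generalize lengthAt A (Submodule.torsionBy B N₁ π) 𝔮 = k₁ at *
    generalize lengthAt A (Submodule.torsionBy B N₂ π) 𝔮 = k₂ at *
    generalize lengthAt A (Submodule.torsionBy B N₃ π) 𝔮 = k₃ at *
    generalize lengthAt A (A ⧸ (charIdeal B N₁).map φ) 𝔮 = r₁ at *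
    generalize lengthAt A (A ⧸ (charIdeal B N₂).map φ) 𝔮 = r₂ at *
    generalize lengthAt A (A ⧸ (charIdeal B N₃).map φ) 𝔮 = r₃ at *
    lift k₁ to ℕ using fK₁
    lift k₃ to ℕ using fK₃
    lift c₁ to ℕ using fC₁
    lift c₃ to ℕ using fC₃
    have fr₁ : r₁ ≠ ⊤ := by rintro rfl; simp at e₁
    have fr₃ : r₃ ≠ ⊤ := by rintro rfl; simp at e₃
    lift r₁ to ℕ using fr₁
    lift r₃ to ℕ using fr₃
    have ec₁ : c₁ = k₁ + r₁ := by exact_mod_cast e₁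
    have ec₃ : c₃ = k₃ + r₃ := by exact_mod_cast e₃
    subst ec₁ ec₃ hr
    induction c₂ using ENat.recTopCoe with
    | top =>
      rw [add_top] at hsnake
      have hk₂ : k₂ = ⊤ := by
        induction k₂ using ENat.recTopCoe with
        | top => rfl
        | coe k₂ => exact absurd hsnake (by exact_mod_cast ENat.coe_ne_top _)
      rw [hk₂, top_add]
    | coe c₂ =>
      have fk₂ : k₂ ≠ ⊤ := by
        rintro rfl
        rw [top_add, top_add] at hsnake
        exact absurd hsnake.symm (by exact_mod_cast ENat.coe_ne_top _)
      lift k₂ to ℕ using fk₂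
      have h : k₂ + (k₁ + r₁) + (k₃ + r₃) = k₁ + k₃ + c₂ := by exact_mod_cast hsnake
      have : c₂ = k₂ + (r₁ + r₃) := by omega
      exact_mod_cast this

end Devissage

/-! ### The Herbrand formula along a retraction, and its one-sided form -/

section Herbrand

variable [IsDomain A] [IsNoetherianRing A] [UniqueFactorizationMonoid A]
  [IsDomain B] [IsNoetherianRing B] [UniqueFactorizationMonoid B]

/-- **Specialisation of characteristic ideals along a retraction (Herbrand form).** Let `A`, `B` be factorial
Noetherian domains, `B` an `A`-algebra with a ring retraction `φ : B → A` whose kernel is `(π)`, `π ≠ 0`, and `N` a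
finitely generated `B`-module killed by some `s` with `φ s ≠ 0`, viewed as an `A`-module compatibly. Then
`char_A(N/πN) = char_A(N[π]) · φ(char_B N)` as ideals of `A`. (Bourbaki AC VII §4.5; for `B = A⟦X⟧`, `π = X` this is
the tree's `PowerSeriesSpecialization.charIdeal_quotSMulTop_eq_mul`, e.g. Delbourgo 2008 Lemma 10.5, Ochiai 2006
Lemma 7.2, Skinner–Urban 2014 Cor. 3.2.9.) [folklore] -/
theorem charIdeal_quotSMulTop_eq_mul_of_retraction (hφ : ∀ a : A, φ (algebraMap A B a) = a) (hφπ : φ π = 0)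
    (hker : ∀ b : B, φ b = 0 → π ∣ b) (hπ0 : π ≠ 0) (N : Type v) [AddCommGroup N] [Module B N]
    [Module.Finite B N] [Module A N] [IsScalarTower A B N]
    (hs : ∃ s : B, φ s ≠ 0 ∧ ∀ m : N, s • m = 0) :
    charIdeal A (QuotSMulTop π N) =
      charIdeal A (Submodule.torsionBy B N π) * (charIdeal B N).map φ := by
  have hdev := lengthAt_quotSMulTop_eq_add_of_retraction hφ hφπ hker hπ0 N ‹_› hs
  obtain ⟨s, hs0, hs⟩ := hs
  obtain ⟨F, hF, hF0⟩ := exists_charIdeal_eq_span_of_retraction (N := N) hφπ hker hπ0 hs0 hs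
  have hmap : (charIdeal B N).map φ = Ideal.span {φ F} := by
    rw [hF, Ideal.map_span, Set.image_singleton]
  rw [hmap, ← Summit.BirchSwinnertonDyer.Rank1Residual.X11b.CongruenceLimit.charIdeal_quotient_span_singleton
    (R := A) hF0]
  haveI : IsNoetherian B N := isNoetherian_of_isNoetherianRing_of_finite _ _
  have hK := (isTorsionBy_map_of_retraction' (N := N) hφ hker hs).2
  have hC := (isTorsionBy_map_of_retraction' (N := N) hφ hker hs).1
  have hQ : Module.IsTorsionBy A (A ⧸ Ideal.span {φ F}) (φ F) := fun x => by
    obtain ⟨a, rfl⟩ := Ideal.Quotient.mk_surjective x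
    change Ideal.Quotient.mk _ (φ F * a) = 0
    rw [Ideal.Quotient.eq_zero_iff_mem]
    exact Ideal.mul_mem_right _ _ (Ideal.mem_span_singleton_self _)
  haveI : Module.Finite A (QuotSMulTop π N) := moduleFinite_quotSMulTop_of_retraction hφ hker
  haveI : Module.Finite A (Submodule.torsionBy B N π) := moduleFinite_torsionBy_of_retraction hφ hker
  unfold charIdeal
  rw [← finprod_mem_mul_distrib' (finite_heightOne_inter_mulSupport hs0 hK)
    (finite_heightOne_inter_mulSupport hF0 hQ)]
  refine finprod_mem_congr rfl fun 𝔮 h𝔮 => ?_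
  rw [← pow_add, hdev 𝔮 h𝔮, PowerSeriesSpecialization.lengthAt_quotient_congr hmap,
    ENat.toNat_add (lengthAt_ne_top_of_isTorsionBy hs0 hK 𝔮 (le_of_eq h𝔮))
      (lengthAt_ne_top_of_isTorsionBy hF0 hQ 𝔮 (le_of_eq h𝔮))]

/-- The case `N[π] = 0` (`π` injective on `N`, `π ≠ 0`): **`char_A(N/πN) = φ(char_B N)`** — the two-sided specialisation
under exact control. [folklore] -/
theorem charIdeal_quotSMulTop_eq_map_of_retraction (hφ : ∀ a : A, φ (algebraMap A B a) = a) (hφπ : φ π = 0)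
    (hker : ∀ b : B, φ b = 0 → π ∣ b) (hπ0 : π ≠ 0) (N : Type v) [AddCommGroup N] [Module B N]
    [Module.Finite B N] [Module A N] [IsScalarTower A B N]
    (hs : ∃ s : B, φ s ≠ 0 ∧ ∀ m : N, s • m = 0) (hX : ∀ m : N, π • m = 0 → m = 0) :
    charIdeal A (QuotSMulTop π N) = (charIdeal B N).map φ := by
  have hK : Submodule.torsionBy B N π = ⊥ :=
    eq_bot_iff.mpr fun m hm =>
      (Submodule.mem_bot _).mpr (hX m ((Submodule.mem_torsionBy_iff _ _).mp hm))
  haveI : Subsingleton (Submodule.torsionBy B N π) := by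
    rw [hK]; infer_instance
  rw [charIdeal_quotSMulTop_eq_mul_of_retraction hφ hφπ hker hπ0 N hs, charIdeal_eq_one_of_subsingleton,
    one_mul]

/-- **One-sided Herbrand specialisation along a retraction: `char_A(N/πN) ≤ φ(char_B N)`** — for EVERY `π`: `A`,
`B` factorial Noetherian domains, `φ : B → A` a ring retraction of the `A`-algebra `B` with kernel `(π)`, `N` a
finitely generated `B`-module killed by some `s ∉ (π)`, with a compatible `A`-structure. For `π ≠ 0` this is
`charIdeal_quotSMulTop_eq_mul_of_retraction` with the factor `char_A(N[π])` dropped; for `π = 0` (`φ` a ring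
isomorphism, `N/0N = N`) it is the equality `char_A(N) = φ(char_B N)` by transport of structure (tree
`Module.charIdeal_eq_map_of_semilinearEquiv`). The text of crux 4's registered stub `stub_herbrandTranslate`
(line «telescope» v4) with universe-polymorphic binders. [folklore] -/
theorem charIdeal_quotSMulTop_le_map_of_retraction (hφ : ∀ a : A, φ (algebraMap A B a) = a)
    (hφπ : φ π = 0) (hker : ∀ b : B, φ b = 0 → π ∣ b) (N : Type v) [AddCommGroup N] [Module B N]
    [Module A N] [IsScalarTower A B N] [Module.Finite B N]
    (hs : ∃ s : B, ¬ π ∣ s ∧ ∀ m : N, s • m = 0) :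
    charIdeal A (QuotSMulTop π N) ≤ (charIdeal B N).map φ := by
  obtain ⟨s, hπs, hs⟩ := hs
  have hs0 : φ s ≠ 0 := fun h => hπs (hker s h)
  by_cases hπ0 : π = 0
  · -- degenerate case `π = 0`: `φ` is a ring isomorphism and `N/0N = N` (transport of structure)
    have hinj : Function.Injective φ := (injective_iff_map_eq_zero φ).2 fun b hb => by
      obtain ⟨c, rfl⟩ := hker b hb
      rw [hπ0, zero_mul]
    let σ : B ≃+* A := RingEquiv.ofBijective φ ⟨hinj, surjective_of_retraction hφ⟩
    have hbot : (π • ⊤ : Submodule B N) = ⊥ := by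
      rw [eq_bot_iff]
      intro x hx
      obtain ⟨y, -, rfl⟩ := (Submodule.mem_smul_pointwise_iff_exists _ _ _).mp hx
      rw [Submodule.mem_bot, hπ0, zero_smul]
    let e : N ≃ₗ[B] QuotSMulTop π N := (Submodule.quotEquivOfEqBot _ hbot).symm
    have he : ∀ (r : B) (m : N), e.toAddEquiv (r • m) = σ r • e.toAddEquiv m := by
      intro r m
      change e (r • m) = φ r • e m
      rw [LinearEquiv.map_smul]
      exact smul_eq_map_smul_of_retraction φ hφ (smul_quotSMulTop_eq_zero' (N := N) hker) r (e m)
    have h := charIdeal_eq_map_of_semilinearEquiv σ e.toAddEquiv he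
    rw [show (σ : B →+* A) = φ from RingHom.ext fun _ => rfl] at h
    exact le_of_eq h
  · rw [charIdeal_quotSMulTop_eq_mul_of_retraction hφ hφπ hker hπ0 N ⟨s, hs0, hs⟩]
    exact Ideal.mul_le_left

end Herbrand

end Summit.BirchSwinnertonDyer.BirchSwinnertonDyer.Theorems.RetractionSpecialization

end
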